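/-
Copyright (c) 2026 the pub-hodgecm-mathlib formalisation cell (harness21).  Prover seat hodgecm-mathlib-K2E2-p12 (g5): Track B «K2-LIT», ENGINE E1,
h413 = stmt-HodgeConjecture-24833; «EIS-WHITTAKER-3» W3₃ (W-asm) sub-brick (U3C-a) «FINITE WHITTAKER PART TRANSPORT» (dealer K2E1-plan (g5) 09:23:57Z (3)).
-/
import Summits.HodgeConjecture.HodgeConjecture.Theorems.K2E1WhittakerCoefficientEulerProductU3B    -- ★ B1 (K2E4-p10 g5): `hasProd_localWhittaker_three` (Tate 3.3.1, ψ-twisted), tokens `W_v(ξ,z)`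
import Summits.HodgeConjecture.HodgeConjecture.Theorems.K2E1WhittakerCoefficientEulerProductU3     -- ★ W3₃-A (K2E4-p10): `hasProd_mul_inv_den_of_eq_off_cm` (regrouping off `S` with the unit values)
import Summits.HodgeConjecture.HodgeConjecture.Theorems.K2E1IntertwiningFiniteTransportU3         -- ★ (3-iv-b) (this seat): `exists_pos_integral_pi_three_eq_smul_integral_prod` (the CM transport, EVERY `G`)
import HarnessLib

/-!
# K2·E1 — `K2E1WhittakerFinitePartTransportU3` («EIS-WHITTAKER-3» W3₃, (W-asm) sub-brick (U3C-a)): THE FINITE PART OF THE `ξ`-TH WHITTAKER COEFFICIENT AS AN EULER PRODUCT —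
# `∫_{𝔸_{L,f}×𝔸_{L⁺,f}} h_f((X_∞,X),b)^{−z}·ψ_{L,f}(ξX) d(μ_{L,f}⊗μ_{L⁺,f}) = C'·μ³(𝒪̂³)·(∏_{v∈S} W_v(ξ,z))·[ζ^S_{L⁺}(z)·L^S(z,ε)·L^S(2z−1,ε)]⁻¹` on `1 < Re z`

Track B ∕ K2-LIT, crux h413 = `stmt-HodgeConjecture-24833`, route of record `HCCMUnconditional`; cell `hodgecm-mathlib`, squad K2, ENGINE E1 (campaign «EIS-WHITTAKER-3», rung W3₃).
THEOREMS ONLY (no `def`, no instance, no notation, no `sorry`; default heartbeats); lane `--supports stmt-HodgeConjecture-24833 --as helper` (count-neutral).  The ψ-TWISTED TWIN of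
★ (3-iv-b) `K2E1IntertwiningFiniteTransportU3.exists_pos_integral_prod_heightFactor_rpow_eq` at a COMPLEX exponent: the SAME transport `(𝔸_{L⁺,f})³ → 𝔸_{L,f} × 𝔸_{L⁺,f}`
(★ (3-iv-b) §1, one Haar constant, EVERY integrand), the complex-power twin of ★ (3-iv-a)'s dictionary, Tate's Theorem 3.3.1 with the character inserted (★ B1
`hasProd_localWhittaker_three`), and ★ W3₃-A's regrouping off `S` with the NAMED unit values `hW` (a LETTER here — paid by (U3C-c) «unit rotation + generic position»).
* §1 `finsetProd_ofReal_cpow` (`(∏ xᵢ)^w = ∏ xᵢ^w` for real `xᵢ ≥ 0` cast to `ℂ`, Mathlib `Complex.mul_cpow_ofReal_nonneg`); **`ofReal_coe_finprod_heightFactor_cpow_neg_eq`**: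
  `(h_f((X_∞, Ψ^∞(a₀,a₁)), b) : ℂ)^{−z} = ∏ᶠ_v (Q_v(a₀|_v,a₁|_v,b|_v) : ℂ)^{−z}` (★ (3-iv-a) `coe_finprod_heightFactor_eq_finprod_localHeight`, finite supports).
* §2 **`exists_pos_integral_prod_heightFactor_cpow_mul_addChar_eq`** (HEAD): ONE constant `C' > 0` with, for every `X_∞`, every `S₀` with `hgood`, every `ξ : L` integral above `S₀ᶜ` (`hξ`),
  every finset `S` carrying the unit values (`hW`), every `z` with `1 < Re z` and the joint integrability letter `hfin` (untwisted integrand):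
  `∫ (h_f((X_∞,X),b):ℂ)^{−z}·ψ_{L,f}(ξ·X) d(μ_{L,f}⊗μ_{L⁺,f}) = C'·μ³(𝒪̂³)·((∏_{v∈S} W_v(ξ,z))·D^S(z)⁻¹)`, `W_v(ξ,z)` = ★ B1's token VERBATIM, `D^S` = ★ W3₃-A's VERBATIM.
HONEST LABEL: HC_CM is proved only modulo the 7 printed citations (2 remaining named inputs: hLiu418 = `stmt-HodgeConjecture-24832`, h413 = `stmt-HodgeConjecture-24833`) until rung 0
closes; this file asserts no named fact and closes no socket; count-neutral; §2 is conditional only on its displayed letters (`hgood`, `hξ`, `hW`, `hfin`).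

## References
* [TateThesis1967] J. Tate, *Fourier analysis in number fields and Hecke's zeta-functions* (1967): Thm 3.3.1, §4.1.
* [Bump1997] D. Bump, *Automorphic Forms and Representations* (1997): §3.7.
* [Rogawski1990] J. D. Rogawski, *Automorphic Representations of Unitary Groups in Three Variables* (1990): §4.5.
* [WeilBNT1967] A. Weil, *Basic Number Theory* (1967): Ch. IV §1.
-/

set_option autoImplicit false
set_option linter.dupNamespace false -- the mandated namespace repeats `HodgeConjecture.HodgeConjecture`

noncomputable section

open MeasureTheory MeasureTheory.Measure NumberField IsDedekindDomain Filter
open scoped NNReal ENNReal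
open Literature.NumberTheory.Automorphic Literature.NumberTheory.Automorphic.UnitaryGroup Literature.NumberTheory.GaloisRepresentations
open Literature.NumberTheory.GaloisRepresentations.IsNonarchimedeanLocalField Literature.NumberTheory.LFunctions
open Summit.HodgeConjecture.HodgeConjecture.Cruxes.H413
open Summit.HodgeConjecture.HodgeConjecture.Cruxes.H413.K2E1WhittakerCoefficientEulerProductU3B (hasProd_localWhittaker_three)
open Summit.HodgeConjecture.HodgeConjecture.Cruxes.H413.K2E1WhittakerCoefficientEulerProductU3 (hasProd_mul_inv_den_of_eq_off_cm)
open Summit.HodgeConjecture.HodgeConjecture.Cruxes.H413.K2E1IntertwiningFiniteTransportU3 (exists_pos_integral_pi_three_eq_smul_integral_prod)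
open Summit.HodgeConjecture.HodgeConjecture.Cruxes.H413.K2E1IntertwiningFiniteHeightDictionaryU3 (coe_finprod_heightFactor_eq_finprod_localHeight
  hasFiniteMulSupport_prod_placesOver_coe_heightFactor coe_max_one_nnnorm_eq)

namespace Summit.HodgeConjecture.HodgeConjecture.Cruxes.H413.K2E1WhittakerFinitePartTransportU3

/-! ## §1 The complex-power dictionary -/

/-- `((∏_{i∈s} xᵢ : ℝ) : ℂ)^w = ∏_{i∈s} (xᵢ : ℂ)^w` for real `xᵢ ≥ 0` (Mathlib `Complex.mul_cpow_ofReal_nonneg`, induction). [folklore] -/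
theorem finsetProd_ofReal_cpow {ι : Type} (s : Finset ι) (f : ι → ℝ) (hf : ∀ i ∈ s, 0 ≤ f i) (w : ℂ) :
    (((∏ i ∈ s, f i : ℝ)) : ℂ) ^ w = ∏ i ∈ s, ((f i : ℝ) : ℂ) ^ w := by
  classical
  induction s using Finset.induction_on with
  | empty => simp
  | insert a s ha ih =>
    rw [Finset.prod_insert ha, Finset.prod_insert ha, Complex.ofReal_mul,
      Complex.mul_cpow_ofReal_nonneg (hf a (Finset.mem_insert_self a s)) (Finset.prod_nonneg fun i hi => hf i (Finset.mem_insert_of_mem hi)),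
      ih fun i hi => hf i (Finset.mem_insert_of_mem hi)]

variable (L : Type) [Field L] [NumberField L] [IsCMField L] {δ : L} (hcδ : IsCMField.complexConj L δ = -δ) (hδ : δ ≠ 0)

/-- **`(h_f((X_∞, Ψ^∞(a₀,a₁)), b) : ℂ)^{−z} = ∏ᶠ_v (Q_v(a₀|_v, a₁|_v, b|_v) : ℂ)^{−z}`** — the complex-power twin of ★ (3-iv-a) `ofReal_coe_finprod_heightFactor_rpow_neg_eq`: the untwisted part of
★ B1's integrand at `x = (a₀, a₁, b)` IS the finite height factor of ★ (a2)₃ to the power `−z`. [cite: TateThesis1967, §3.3] -/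
theorem ofReal_coe_finprod_heightFactor_cpow_neg_eq (Xinf : InfiniteAdeleRing L) (a₀ a₁ b : FiniteAdeleRing (𝓞 ↥(maximalRealSubfield L)) ↥(maximalRealSubfield L)) (z : ℂ) :
    ((((∏ᶠ w : HeightOneSpectrum (𝓞 L), max 1 (max ‖((Xinf, quadraticFiniteAdeleMap ↥(maximalRealSubfield L) L δ (a₀, a₁)) : AdeleRing (𝓞 L) L).2 w‖₊ ‖(heisZ (c := IsCMField.complexConj L) ((Xinf, quadraticFiniteAdeleMap ↥(maximalRealSubfield L) L δ (a₀, a₁)) : AdeleRing (𝓞 L) L) ((traceZeroLine ↥(maximalRealSubfield L) L (IsCMField.complexConj L) hcδ hδ ((0, b) : AdeleRing (𝓞 ↥(maximalRealSubfield L)) ↥(maximalRealSubfield L)) : traceZeroAdele ↥(maximalRealSubfield L) L (IsCMField.complexConj L)) : AdeleRing (𝓞 L) L)).2 w‖₊) : ℝ≥0) : ℝ) : ℂ) ^ (-z)) =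
      ∏ᶠ v : HeightOneSpectrum (𝓞 ↥(maximalRealSubfield L)), ((((∏ w' : PlacesOver L v, max 1 (max ((normAbs (w'.1.adicCompletion L) (quadraticLocalEquiv L v (IsCMField.complexConj L) hcδ hδ (a₀ v, a₁ v) w') : ℝ≥0) : ℝ)
          ((normAbs (w'.1.adicCompletion L) ((toLocalRing L v (b v) * algebraMap L (LocalRing L v) δ -
            toLocalRing L v 2⁻¹ * (quadraticLocalEquiv L v (IsCMField.complexConj L) hcδ hδ (a₀ v, a₁ v) *
              conjLocal L (IsCMField.complexConj L) v (quadraticLocalEquiv L v (IsCMField.complexConj L) hcδ hδ (a₀ v, a₁ v)))) w') : ℝ≥0) : ℝ))) : ℝ) : ℂ) ^ (-z)) := by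
  rw [coe_finprod_heightFactor_eq_finprod_localHeight L hcδ hδ Xinf a₀ a₁ b]
  have hfin := hasFiniteMulSupport_prod_placesOver_coe_heightFactor L
    ((Xinf, quadraticFiniteAdeleMap ↥(maximalRealSubfield L) L δ (a₀, a₁)) : AdeleRing (𝓞 L) L)
    (heisZ (c := IsCMField.complexConj L) ((Xinf, quadraticFiniteAdeleMap ↥(maximalRealSubfield L) L δ (a₀, a₁)) : AdeleRing (𝓞 L) L)
      ((traceZeroLine ↥(maximalRealSubfield L) L (IsCMField.complexConj L) hcδ hδ ((0, b) : AdeleRing (𝓞 ↥(maximalRealSubfield L)) ↥(maximalRealSubfield L)) : traceZeroAdele ↥(maximalRealSubfield L) L (IsCMField.complexConj L)) : AdeleRing (𝓞 L) L))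
  have hpt : ∀ v : HeightOneSpectrum (𝓞 ↥(maximalRealSubfield L)),
      (∏ w : PlacesOver L v, ((max 1 (max ‖((Xinf, quadraticFiniteAdeleMap ↥(maximalRealSubfield L) L δ (a₀, a₁)) : AdeleRing (𝓞 L) L).2 w.1‖₊
        ‖(heisZ (c := IsCMField.complexConj L) ((Xinf, quadraticFiniteAdeleMap ↥(maximalRealSubfield L) L δ (a₀, a₁)) : AdeleRing (𝓞 L) L)
          ((traceZeroLine ↥(maximalRealSubfield L) L (IsCMField.complexConj L) hcδ hδ ((0, b) : AdeleRing (𝓞 ↥(maximalRealSubfield L)) ↥(maximalRealSubfield L)) : traceZeroAdele ↥(maximalRealSubfield L) L (IsCMField.complexConj L)) : AdeleRing (𝓞 L) L)).2 w.1‖₊) : ℝ≥0) : ℝ)) =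
      (∏ w' : PlacesOver L v, max 1 (max ((normAbs (w'.1.adicCompletion L) (quadraticLocalEquiv L v (IsCMField.complexConj L) hcδ hδ (a₀ v, a₁ v) w') : ℝ≥0) : ℝ)
          ((normAbs (w'.1.adicCompletion L) ((toLocalRing L v (b v) * algebraMap L (LocalRing L v) δ -
            toLocalRing L v 2⁻¹ * (quadraticLocalEquiv L v (IsCMField.complexConj L) hcδ hδ (a₀ v, a₁ v) *
              conjLocal L (IsCMField.complexConj L) v (quadraticLocalEquiv L v (IsCMField.complexConj L) hcδ hδ (a₀ v, a₁ v)))) w') : ℝ≥0) : ℝ))) :=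
    fun v => Finset.prod_congr rfl fun w _ => coe_max_one_nnnorm_eq L hcδ hδ Xinf a₀ a₁ b v w
  simp_rw [hpt] at hfin
  set T := hfin.toFinset with hT
  have hsub : (Function.mulSupport fun v : HeightOneSpectrum (𝓞 ↥(maximalRealSubfield L)) => (∏ w' : PlacesOver L v, max 1 (max ((normAbs (w'.1.adicCompletion L) (quadraticLocalEquiv L v (IsCMField.complexConj L) hcδ hδ (a₀ v, a₁ v) w') : ℝ≥0) : ℝ)
          ((normAbs (w'.1.adicCompletion L) ((toLocalRing L v (b v) * algebraMap L (LocalRing L v) δ -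
            toLocalRing L v 2⁻¹ * (quadraticLocalEquiv L v (IsCMField.complexConj L) hcδ hδ (a₀ v, a₁ v) *
              conjLocal L (IsCMField.complexConj L) v (quadraticLocalEquiv L v (IsCMField.complexConj L) hcδ hδ (a₀ v, a₁ v)))) w') : ℝ≥0) : ℝ)))) ⊆ ↑T := by
    rw [hT, Set.Finite.coe_toFinset]
  have hsub' : (Function.mulSupport fun v : HeightOneSpectrum (𝓞 ↥(maximalRealSubfield L)) => ((((∏ w' : PlacesOver L v, max 1 (max ((normAbs (w'.1.adicCompletion L) (quadraticLocalEquiv L v (IsCMField.complexConj L) hcδ hδ (a₀ v, a₁ v) w') : ℝ≥0) : ℝ)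
          ((normAbs (w'.1.adicCompletion L) ((toLocalRing L v (b v) * algebraMap L (LocalRing L v) δ -
            toLocalRing L v 2⁻¹ * (quadraticLocalEquiv L v (IsCMField.complexConj L) hcδ hδ (a₀ v, a₁ v) *
              conjLocal L (IsCMField.complexConj L) v (quadraticLocalEquiv L v (IsCMField.complexConj L) hcδ hδ (a₀ v, a₁ v)))) w') : ℝ≥0) : ℝ))) : ℝ) : ℂ) ^ (-z))) ⊆ ↑T := by
    intro v hv
    by_contra hvT
    have h1 := Function.notMem_mulSupport.1 (fun h => hvT (hsub h))
    exact hv (by simp only [h1, Complex.ofReal_one, Complex.one_cpow])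
  rw [finprod_eq_prod_of_mulSupport_subset _ hsub, finprod_eq_prod_of_mulSupport_subset _ hsub',
    finsetProd_ofReal_cpow _ _ (fun v _ => Finset.prod_nonneg fun w _ => le_trans zero_le_one (le_max_left _ _))]

/-! ## §2 HEAD: the ψ-twisted finite double integral is `C'·μ³(𝒪̂³)·(∏_{v∈S} W_v(ξ,z))·D^S(z)⁻¹` -/

variable [MeasurableSpace (FiniteAdeleRing (𝓞 ↥(maximalRealSubfield L)) ↥(maximalRealSubfield L))] [BorelSpace (FiniteAdeleRing (𝓞 ↥(maximalRealSubfield L)) ↥(maximalRealSubfield L))]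
  [MeasurableSpace (FiniteAdeleRing (𝓞 L) L)] [BorelSpace (FiniteAdeleRing (𝓞 L) L)]
  (μFf : Measure (FiniteAdeleRing (𝓞 ↥(maximalRealSubfield L)) ↥(maximalRealSubfield L))) [μFf.IsAddHaarMeasure]
  (μEf : Measure (FiniteAdeleRing (𝓞 L) L)) [μEf.IsAddHaarMeasure]

/-- **THE FINITE PART OF THE `ξ`-TH WHITTAKER COEFFICIENT OF THE SPHERICAL SECTION OF `U(2,1)_{L∕L⁺}`, AS AN EULER PRODUCT** (`1 < Re z`): there is ONE constant `C' > 0` (the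
CM transport constant of ★ (3-iv-b) §1, inverted) such that for every archimedean parameter `X_∞`, every bad finset `S₀` (`hgood`), every `ξ : L` integral above `S₀ᶜ` (`hξ`),
every finset `S` carrying the NAMED unit values `hW` of ★ B1's local tokens `W_v(ξ,z)`, and the joint integrability letter `hfin`:
`∫ (h_f((X_∞,X),b) : ℂ)^{−z}·ψ_{L,f}(ξX) d(μ_{L,f}⊗μ_{L⁺,f})(X,b) = C'·μ³(𝒪̂³)·((∏_{v∈S} W_v(ξ,z))·[ζ^S_{L⁺}(z)L^S(z,ε)L^S(2z−1,ε)]⁻¹)` (★ (3-iv-b) §1 ∘ §1 ∘ ★ B1 ∘ ★ W3₃-A).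
[cite: TateThesis1967, Thm 3.3.1, §4.1] [cite: Bump1997, §3.7] [cite: Rogawski1990, §4.5] [cite: WeilBNT1967, Ch. IV §1] -/
theorem exists_pos_integral_prod_heightFactor_cpow_mul_addChar_eq {d : ↥(maximalRealSubfield L)} (hd : δ * δ = algebraMap ↥(maximalRealSubfield L) L d)
    [∀ v : HeightOneSpectrum (𝓞 ↥(maximalRealSubfield L)), MeasurableSpace (v.adicCompletion ↥(maximalRealSubfield L))] [∀ v : HeightOneSpectrum (𝓞 ↥(maximalRealSubfield L)), BorelSpace (v.adicCompletion ↥(maximalRealSubfield L))]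
    (νv : ∀ v : HeightOneSpectrum (𝓞 ↥(maximalRealSubfield L)), Measure (v.adicCompletion ↥(maximalRealSubfield L))) [∀ v, (νv v).IsAddHaarMeasure] :
    ∃ C' : ℝ≥0, 0 < C' ∧ ∀ (Xinf : InfiniteAdeleRing L) (S₀ : Finset (HeightOneSpectrum (𝓞 ↥(maximalRealSubfield L))))
      (hgood : ∀ v ∉ S₀, Algebra.IsUnramifiedIn (𝓞 L) v.asIdeal ∧ Valued.v (2 : v.adicCompletion ↥(maximalRealSubfield L)) = 1 ∧
        ∀ w : PlacesOver L v, Valued.v (algebraMap L (LocalRing L v) δ w) = 1)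
      (ξ : L) (hξ : ∀ v ∉ S₀, ∀ w' : PlacesOver L v, (ξ : w'.1.adicCompletion L) ∈ w'.1.adicCompletionIntegers L)
      (S : Finset (HeightOneSpectrum (𝓞 ↥(maximalRealSubfield L)))) {z : ℂ} (hz : 1 < z.re)
      (hfin : Integrable (fun q : FiniteAdeleRing (𝓞 L) L × FiniteAdeleRing (𝓞 ↥(maximalRealSubfield L)) ↥(maximalRealSubfield L) => ((((∏ᶠ w : HeightOneSpectrum (𝓞 L), max 1 (max ‖((Xinf, q.1) : AdeleRing (𝓞 L) L).2 w‖₊ ‖(heisZ (c := IsCMField.complexConj L) ((Xinf, q.1) : AdeleRing (𝓞 L) L) ((traceZeroLine ↥(maximalRealSubfield L) L (IsCMField.complexConj L) hcδ hδ ((0, q.2) : AdeleRing (𝓞 ↥(maximalRealSubfield L)) ↥(maximalRealSubfield L)) : traceZeroAdele ↥(maximalRealSubfield L) L (IsCMField.complexConj L)) : AdeleRing (𝓞 L) L)).2 w‖₊) : ℝ≥0) : ℝ) : ℂ) ^ (-z))) (μEf.prod μFf))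
      (hW : ∀ v ∉ S, ((Measure.pi fun _ : Fin 3 => νv v) (integralBox ↥(maximalRealSubfield L) (Fin 3) v)).toReal⁻¹ •
          ∫ p : Fin 3 → v.adicCompletion ↥(maximalRealSubfield L),
            ((((∏ w' : PlacesOver L v, max 1 (max ((normAbs (w'.1.adicCompletion L) (quadraticLocalEquiv L v (IsCMField.complexConj L) hcδ hδ (p 0, p 1) w') : ℝ≥0) : ℝ)
          ((normAbs (w'.1.adicCompletion L) ((toLocalRing L v (p 2) * algebraMap L (LocalRing L v) δ -
            toLocalRing L v 2⁻¹ * (quadraticLocalEquiv L v (IsCMField.complexConj L) hcδ hδ (p 0, p 1) *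
              conjLocal L (IsCMField.complexConj L) v (quadraticLocalEquiv L v (IsCMField.complexConj L) hcδ hδ (p 0, p 1)))) w') : ℝ≥0) : ℝ))) : ℝ) : ℂ) ^ (-z)) *
              (∏ w' : PlacesOver L v, (adeleAddCharAt L w'.1 ((ξ : w'.1.adicCompletion L) * quadraticLocalEquiv L v (IsCMField.complexConj L) hcδ hδ (p 0, p 1) w') : ℂ))
            ∂(Measure.pi fun _ : Fin 3 => νv v) =
        (1 - (v.residueCard : ℂ) ^ (-z)) * (1 - (quadraticHeckeCharCM L).valueAtUniformizer v * (v.residueCard : ℂ) ^ (-z)) *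
        (1 - (quadraticHeckeCharCM L).valueAtUniformizer v * (v.residueCard : ℂ) ^ (-(2 * z - 1)))),
      ∫ q : FiniteAdeleRing (𝓞 L) L × FiniteAdeleRing (𝓞 ↥(maximalRealSubfield L)) ↥(maximalRealSubfield L),
          ((((∏ᶠ w : HeightOneSpectrum (𝓞 L), max 1 (max ‖((Xinf, q.1) : AdeleRing (𝓞 L) L).2 w‖₊ ‖(heisZ (c := IsCMField.complexConj L) ((Xinf, q.1) : AdeleRing (𝓞 L) L) ((traceZeroLine ↥(maximalRealSubfield L) L (IsCMField.complexConj L) hcδ hδ ((0, q.2) : AdeleRing (𝓞 ↥(maximalRealSubfield L)) ↥(maximalRealSubfield L)) : traceZeroAdele ↥(maximalRealSubfield L) L (IsCMField.complexConj L)) : AdeleRing (𝓞 L) L)).2 w‖₊) : ℝ≥0) : ℝ) : ℂ) ^ (-z)) * (finiteAdeleAddChar L (algebraMap L (FiniteAdeleRing (𝓞 L) L) ξ * (q.1)) : ℂ) ∂(μEf.prod μFf) =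
        (C' : ℂ) * ((((Measure.pi fun _ : Fin 3 => μFf) (offBox (K := ↥(maximalRealSubfield L)) (ι := Fin 3) ∅)).toReal : ℂ) *
          ((∏ v ∈ S, ((Measure.pi fun _ : Fin 3 => νv v) (integralBox ↥(maximalRealSubfield L) (Fin 3) v)).toReal⁻¹ •
          ∫ p : Fin 3 → v.adicCompletion ↥(maximalRealSubfield L),
            ((((∏ w' : PlacesOver L v, max 1 (max ((normAbs (w'.1.adicCompletion L) (quadraticLocalEquiv L v (IsCMField.complexConj L) hcδ hδ (p 0, p 1) w') : ℝ≥0) : ℝ)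
          ((normAbs (w'.1.adicCompletion L) ((toLocalRing L v (p 2) * algebraMap L (LocalRing L v) δ -
            toLocalRing L v 2⁻¹ * (quadraticLocalEquiv L v (IsCMField.complexConj L) hcδ hδ (p 0, p 1) *
              conjLocal L (IsCMField.complexConj L) v (quadraticLocalEquiv L v (IsCMField.complexConj L) hcδ hδ (p 0, p 1)))) w') : ℝ≥0) : ℝ))) : ℝ) : ℂ) ^ (-z)) *
              (∏ w' : PlacesOver L v, (adeleAddCharAt L w'.1 ((ξ : w'.1.adicCompletion L) * quadraticLocalEquiv L v (IsCMField.complexConj L) hcδ hδ (p 0, p 1) w') : ℂ))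
            ∂(Measure.pi fun _ : Fin 3 => νv v)) *
            (partialStandardL (↑S : Set (HeightOneSpectrum (𝓞 ↥(maximalRealSubfield L)))) (fun _ => {1}) z *
              partialStandardL (↑S : Set (HeightOneSpectrum (𝓞 ↥(maximalRealSubfield L)))) (fun v => {(quadraticHeckeCharCM L).valueAtUniformizer v}) z *
              partialStandardL (↑S : Set (HeightOneSpectrum (𝓞 ↥(maximalRealSubfield L)))) (fun v => {(quadraticHeckeCharCM L).valueAtUniformizer v}) (2 * z - 1))⁻¹)) := by
  haveI : SecondCountableTopology (FiniteAdeleRing (𝓞 ↥(maximalRealSubfield L)) ↥(maximalRealSubfield L)) := secondCountableTopology_finiteAdeleRing _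
  haveI : LocallyCompactSpace (FiniteAdeleRing (𝓞 ↥(maximalRealSubfield L)) ↥(maximalRealSubfield L)) := locallyCompactSpace_finiteAdeleRing' _
  obtain ⟨C, hC, hall⟩ := exists_pos_integral_pi_three_eq_smul_integral_prod L μFf μEf hcδ hδ
  refine ⟨C⁻¹, inv_pos.2 hC, fun Xinf S₀ hgood ξ hξ S z hz hfin hW => ?_⟩
  -- the transport, twisted and untwisted
  obtain ⟨hval, -⟩ := hall fun X b => ((((∏ᶠ w : HeightOneSpectrum (𝓞 L), max 1 (max ‖((Xinf, X) : AdeleRing (𝓞 L) L).2 w‖₊ ‖(heisZ (c := IsCMField.complexConj L) ((Xinf, X) : AdeleRing (𝓞 L) L) ((traceZeroLine ↥(maximalRealSubfield L) L (IsCMField.complexConj L) hcδ hδ ((0, b) : AdeleRing (𝓞 ↥(maximalRealSubfield L)) ↥(maximalRealSubfield L)) : traceZeroAdele ↥(maximalRealSubfield L) L (IsCMField.complexConj L)) : AdeleRing (𝓞 L) L)).2 w‖₊) : ℝ≥0) : ℝ) : ℂ) ^ (-z)) * (finiteAdeleAddChar L (algebraMap L (FiniteAdeleRing (𝓞 L)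 L) ξ * (X)) : ℂ)
  obtain ⟨-, hiff⟩ := hall fun X b => ((((∏ᶠ w : HeightOneSpectrum (𝓞 L), max 1 (max ‖((Xinf, X) : AdeleRing (𝓞 L) L).2 w‖₊ ‖(heisZ (c := IsCMField.complexConj L) ((Xinf, X) : AdeleRing (𝓞 L) L) ((traceZeroLine ↥(maximalRealSubfield L) L (IsCMField.complexConj L) hcδ hδ ((0, b) : AdeleRing (𝓞 ↥(maximalRealSubfield L)) ↥(maximalRealSubfield L)) : traceZeroAdele ↥(maximalRealSubfield L) L (IsCMField.complexConj L)) : AdeleRing (𝓞 L) L)).2 w‖₊) : ℝ≥0) : ℝ) : ℂ) ^ (-z))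
  have hpt : (fun x : Fin 3 → FiniteAdeleRing (𝓞 ↥(maximalRealSubfield L)) ↥(maximalRealSubfield L) =>
      ((((∏ᶠ w : HeightOneSpectrum (𝓞 L), max 1 (max ‖((Xinf, quadraticFiniteAdeleMap ↥(maximalRealSubfield L) L δ (x 0, x 1)) : AdeleRing (𝓞 L) L).2 w‖₊ ‖(heisZ (c := IsCMField.complexConj L) ((Xinf, quadraticFiniteAdeleMap ↥(maximalRealSubfield L) L δ (x 0, x 1)) : AdeleRing (𝓞 L) L) ((traceZeroLine ↥(maximalRealSubfield L) L (IsCMField.complexConj L) hcδ hδ ((0, x 2) : AdeleRing (𝓞 ↥(maximalRealSubfield L)) ↥(maximalRealSubfield L)) : traceZeroAdele ↥(maximalRealSubfield L) L (IsCMField.complexConj L)) : AdeleRing (𝓞 L) L)).2 w‖₊) : ℝ≥0) : ℝ) : ℂ) ^ (-z)) * (finiteAdeleAddChar L (algebraMap L (FiniteAdeleRing (𝓞 L) L) ξ * (quadraticFiniteAdeleMap ↥(maximalRealSubfield L) L δ (x 0, x 1))) : ℂ)) =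
      fun x => (∏ᶠ v : HeightOneSpectrum (𝓞 ↥(maximalRealSubfield L)), ((((∏ w' : PlacesOver L v, max 1 (max ((normAbs (w'.1.adicCompletion L) (quadraticLocalEquiv L v (IsCMField.complexConj L) hcδ hδ (x 0 v, x 1 v) w') : ℝ≥0) : ℝ)
          ((normAbs (w'.1.adicCompletion L) ((toLocalRing L v (x 2 v) * algebraMap L (LocalRing L v) δ -
            toLocalRing L v 2⁻¹ * (quadraticLocalEquiv L v (IsCMField.complexConj L) hcδ hδ (x 0 v, x 1 v) *
              conjLocal L (IsCMField.complexConj L) v (quadraticLocalEquiv L v (IsCMField.complexConj L) hcδ hδ (x 0 v, x 1 v)))) w') : ℝ≥0) : ℝ))) : ℝ) : ℂ) ^ (-z))) * (finiteAdeleAddChar L (algebraMap L (FiniteAdeleRing (𝓞 L) L) ξ * (quadraticFiniteAdeleMap ↥(maximalRealSubfield L) L δ (x 0, x 1))) : ℂ) :=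
    funext fun x => by rw [ofReal_coe_finprod_heightFactor_cpow_neg_eq L hcδ hδ Xinf (x 0) (x 1) (x 2) z]
  have hpt0 : (fun x : Fin 3 → FiniteAdeleRing (𝓞 ↥(maximalRealSubfield L)) ↥(maximalRealSubfield L) => ((((∏ᶠ w : HeightOneSpectrum (𝓞 L), max 1 (max ‖((Xinf, quadraticFiniteAdeleMap ↥(maximalRealSubfield L) L δ (x 0, x 1)) : AdeleRing (𝓞 L) L).2 w‖₊ ‖(heisZ (c := IsCMField.complexConj L) ((Xinf, quadraticFiniteAdeleMap ↥(maximalRealSubfield L) L δ (x 0, x 1)) : AdeleRing (𝓞 L) L) ((traceZeroLine ↥(maximalRealSubfield L) L (IsCMField.complexConj L) hcδ hδ ((0, x 2) : AdeleRing (𝓞 ↥(maximalRealSubfield L)) ↥(maximalRealSubfield L)) : traceZeroAdele ↥(maximalRealSubfield L) L (IsCMField.complexConj L)) : AdeleRing (𝓞 L) L)).2 w‖₊) : ℝ≥0) : ℝ) : ℂ) ^ (-z))) =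
      fun x => ∏ᶠ v : HeightOneSpectrum (𝓞 ↥(maximalRealSubfield L)), ((((∏ w' : PlacesOver L v, max 1 (max ((normAbs (w'.1.adicCompletion L) (quadraticLocalEquiv L v (IsCMField.complexConj L) hcδ hδ (x 0 v, x 1 v) w') : ℝ≥0) : ℝ)
          ((normAbs (w'.1.adicCompletion L) ((toLocalRing L v (x 2 v) * algebraMap L (LocalRing L v) δ -
            toLocalRing L v 2⁻¹ * (quadraticLocalEquiv L v (IsCMField.complexConj L) hcδ hδ (x 0 v, x 1 v) *
              conjLocal L (IsCMField.complexConj L) v (quadraticLocalEquiv L v (IsCMField.complexConj L) hcδ hδ (x 0 v, x 1 v)))) w') : ℝ≥0) : ℝ))) : ℝ) : ℂ) ^ (-z)) :=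
    funext fun x => ofReal_coe_finprod_heightFactor_cpow_neg_eq L hcδ hδ Xinf (x 0) (x 1) (x 2) z
  rw [hpt] at hval
  rw [hpt0] at hiff
  -- Tate 3.3.1 with the character (★ B1) and the regrouping off `S` (★ W3₃-A)
  have hP := hasProd_localWhittaker_three L hcδ hδ hd S₀ (Measure.pi fun _ : Fin 3 => μFf) νv hgood z ξ hξ (hiff.2 hfin)
  have hE := (hasProd_mul_inv_den_of_eq_off_cm L S hz hW).1
  have huniq := hP.unique hE
  -- `μ³(𝒪̂³)⁻¹ • ∫ = P` ⟹ `∫ = μ³(𝒪̂³) · P`; then `C • I = ∫` ⟹ `I = C⁻¹ · ∫`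
  have hc0 : ((Measure.pi fun _ : Fin 3 => μFf) (offBox (K := ↥(maximalRealSubfield L)) (ι := Fin 3) ∅)).toReal ≠ 0 :=
    ENNReal.toReal_ne_zero.mpr ⟨(measure_offBox_empty_pos ↥(maximalRealSubfield L) (Fin 3) _).ne', (measure_offBox_empty_lt_top ↥(maximalRealSubfield L) (Fin 3) _).ne⟩
  rw [Complex.real_smul, Complex.ofReal_inv, inv_mul_eq_iff_eq_mul₀ (by exact_mod_cast hc0)] at huniq
  rw [huniq, Complex.real_smul] at hval
  have hC0 : (C : ℂ) ≠ 0 := by exact_mod_cast hC.ne'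
  rw [← inv_mul_eq_iff_eq_mul₀ hC0] at hval
  rw [← hval, NNReal.coe_inv, Complex.ofReal_inv, mul_assoc]

end Summit.HodgeConjecture.HodgeConjecture.Cruxes.H413.K2E1WhittakerFinitePartTransportU3

end
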